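/-
Copyright (c) 2026. All rights reserved.
Released under Apache 2.0 license as described in the file LICENSE.
Authors: abc-iut cell, wave-2 seat abc-iut-L3-t11 (proof-only; row «EdgeLikeDistinct DISCHARGE»: edge-like
subgroups of distinct edges are not commensurable, from Thm 3.7 (i)(ii)(iii)).
-/
import Literature.AnabelianGeometry.SemiGraphs.TemperedEdgeInVerticialProofs
import Literature.AnabelianGeometry.SemiGraphs.TemperedNoFixedBranchPair
import Literature.AnabelianGeometry.SemiGraphs.MorphismsOver
import Literature.AnabelianGeometry.SemiGraphs.TreeSystemFixedClosedEdges
import HarnessLib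

/-!
# [SemiAnbd] Thm 3.7: edge-like subgroups of distinct edges meet trivially and are infinite

Mochizuki, *Semi-graphs of anabelioids*, Publ. RIMS **42** (2006) [MochizukiSemiAnbd2006], Thm 3.7 (iii)/(iv)
p. 41 ("the nontrivial intersections of two distinct maximal compact subgroups … are precisely the edge-like
subgroups") with Def 2.4 (i) (elevated), (iv) (aloof / estranged) p. 26, and the proof of Cor 3.9 p. 42 ("all
of the edge-like subgroups of `π₁^temp(ℋ)` are infinite").

PROOF-ONLY (no definitions). For a semi-graph of anabelioids `G` satisfying the hypotheses of Thm 3.7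
(abc-iut-L3-t2's local presentation `ProfiniteSemiGraph.Thm37Hypotheses`) and a chart `c` of `π₁^temp(G)`,
GIVEN the named facts Thm 3.7 (i) `VerticialInjective`, (ii) `VerticialDistinct`, (iii) `CompactInVerticial`:
* `edgeLike_eq_map_branchSubgroup` — an edge-like subgroup of `e = edgeOf b` (`b` at `v`) is
  `g·φ(Π_b)·g⁻¹` for any verticial `φ : Π_v → π₁^temp` (Prop 3.2 on `B^temp(ψ) ≅ B^temp(φ ∘ b_*)`);
* `map_branch_inf_eq_bot_of_ne` (LEMMA E) — inside ONE verticial subgroup `g₁φ(Π_v)g₁⁻¹ = g₂φ(Π_v)g₂⁻¹`,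
  the images of `Π_{b₁}`, `Π_{b₂}` for distinct branches `b₁ ≠ b₂` at `v` meet trivially (commensurable
  terminality = `VerticialDistinct` clause 2 puts `g₁⁻¹g₂` in `φ(Π_v)`; then total estrangement);
* `branchSubgroup_ne_top`, `infinite_branchSubgroup`, `infinite_of_mem_edgeLikeSubgroups` — `Π_b ≠ Π_v`
  (elevated), hence `Π_b` is infinite (aloof), hence so is every edge-like subgroup;
* `edgeLike_inf_edgeLike_eq_bot` — edge-like subgroups `L₁`, `L₂` of DISTINCT edges meet trivially: if
  their verticial hosts agree, LEMMA E; if not, `L₁ ⊓ L₂` is a nontrivial compact subgroup in two distinct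
  verticial subgroups, so by (iii) these are its only hosts and it lies in an edge-like subgroup of a closed
  edge `e`, whose two hosts must then be those two — forcing `e = e₁ = e₂`;
* `relIndex_edgeLike_eq_zero` — hence `[L₁ : L₁ ∩ L₂] = ∞` (`relIndex = 0`), the statement
  `EdgeLikeDistinct` of abc-iut-L3-d2's `TemperedEdgeLikeDistinct.lean` unfolded.
-/

namespace Literature.AnabelianGeometry.SemiGraphs

open CategoryTheory Topology

universe u

namespace ProfiniteSemiGraph

variable {𝒢 : ProfiniteSemiGraph.{u}}

/-! ### Edge-like subgroups as conjugates of branch images -/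

/-- **An edge-like subgroup of `e = edgeOf b` is `g·φ(Π_b)·g⁻¹`** for any verticial `φ : Π_v → π₁^temp` at
the vertex `v` of `b` (Prop 3.2 applied to `B^temp(ψ) ≅ B^temp(φ ∘ b_*)`). [cite: MochizukiSemiAnbd2006, Thm 3.7(iii) p.41] -/
theorem edgeLike_eq_map_branchSubgroup (c : TemperedPiChart 𝒢) {b : 𝒢.graph.Branch}
    {v : 𝒢.graph.Vertex} (h : 𝒢.graph.abuts b = some v) {L : Subgroup c.G}
    (hL : L ∈ edgeLikeSubgroups c (𝒢.graph.edgeOf b)) (φ : 𝒢.Gv v →ₜ* c.G) (hφ : IsVerticialHom c v φ) :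
    ∃ g : c.G, L = ((𝒢.branchSubgroup b v h).map φ.toMonoidHom).map (MulAut.conj g).toMonoidHom := by
  obtain ⟨ψ, ⟨iE⟩, rfl⟩ := hL
  obtain ⟨iV⟩ := hφ
  obtain ⟨i⟩ := nonempty_res_iso_res_comp_brHom c b v h ψ φ iE iV
  obtain ⟨g, hg, -⟩ := BTemp.exists_conj_of_natTrans c.isTempered (φ.comp (𝒢.brHom b v h)) ψ i.inv
  refine ⟨g, ?_⟩
  rw [range_eq_map_conj_of_conj_eq c (φ.comp (𝒢.brHom b v h)) ψ g hg]
  congr 1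
  ext x
  simp only [MonoidHom.mem_range, ContinuousMonoidHom.coe_toMonoidHom, Subgroup.mem_map, branchSubgroup]
  constructor
  · rintro ⟨a, rfl⟩; exact ⟨𝒢.brHom b v h a, ⟨a, rfl⟩, rfl⟩
  · rintro ⟨_, ⟨a, rfl⟩, rfl⟩; exact ⟨a, rfl⟩

/-- The verticial subgroup `φ(Π_v)` of a verticial homomorphism. [cite: MochizukiSemiAnbd2006, Thm 3.7(i) p.40] -/
theorem range_mem_verticialSubgroups (c : TemperedPiChart 𝒢) {v : 𝒢.graph.Vertex}
    (φ : 𝒢.Gv v →ₜ* c.G) (hφ : IsVerticialHom c v φ) : φ.toMonoidHom.range ∈ verticialSubgroups c v :=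
  ⟨φ, hφ, rfl⟩

/-! ### LEMMA E: distinct branches inside one verticial subgroup -/

/-- **LEMMA E.** For a verticial `φ : Π_v → π₁^temp`, conjugators with `g₁φ(Π_v)g₁⁻¹ = g₂φ(Π_v)g₂⁻¹`, and
DISTINCT branches `b₁ ≠ b₂` at `v`: `g₁φ(Π_{b₁})g₁⁻¹ ∩ g₂φ(Π_{b₂})g₂⁻¹ = 1`. (Commensurable terminality —
`VerticialDistinct`, second clause — gives `g₁⁻¹g₂ ∈ φ(Π_v)`; then total estrangement in `Π_v` and
injectivity of `φ`.) [cite: MochizukiSemiAnbd2006, Thm 3.7(iii) p.41] -/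
theorem map_branch_inf_eq_bot_of_ne (hVD : VerticialDistinct.{u}) (hVI : VerticialInjective.{u})
    (h𝒢 : 𝒢.Thm37Hypotheses) (c : TemperedPiChart 𝒢) {v : 𝒢.graph.Vertex} (φ : 𝒢.Gv v →ₜ* c.G)
    (hφ : IsVerticialHom c v φ) {b₁ b₂ : 𝒢.graph.Branch} (h₁ : 𝒢.graph.abuts b₁ = some v)
    (h₂ : 𝒢.graph.abuts b₂ = some v) (hne : b₁ ≠ b₂) (g₁ g₂ : c.G)
    (hH : φ.toMonoidHom.range.map (MulAut.conj g₁).toMonoidHom =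
      φ.toMonoidHom.range.map (MulAut.conj g₂).toMonoidHom) :
    ((𝒢.branchSubgroup b₁ v h₁).map φ.toMonoidHom).map (MulAut.conj g₁).toMonoidHom ⊓
      ((𝒢.branchSubgroup b₂ v h₂).map φ.toMonoidHom).map (MulAut.conj g₂).toMonoidHom = ⊥ := by
  -- commensurable terminality: `g₁⁻¹ g₂ ∈ φ(Π_v)`
  have hmem : g₁⁻¹ * g₂ ∈ φ.toMonoidHom.range := by
    by_contra hn
    have h0 := (hVD 𝒢 h𝒢 c).2 v _ (range_mem_verticialSubgroups c φ hφ) g₁ g₂ hn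
    rw [hH, Subgroup.relIndex_self] at h0
    exact one_ne_zero h0
  obtain ⟨y, hy⟩ := hmem
  -- rewrite the second conjugate through `g₁` and `y`
  have hg₂ : g₂ = g₁ * φ.toMonoidHom y := by
    rw [hy, mul_inv_cancel_left]
  have hnat : (MulAut.conj g₂).toMonoidHom.comp φ.toMonoidHom =
      ((MulAut.conj g₁).toMonoidHom.comp φ.toMonoidHom).comp (MulAut.conj y).toMonoidHom := by
    ext x; simp [hg₂, mul_assoc]
  have h2 : ((𝒢.branchSubgroup b₂ v h₂).map φ.toMonoidHom).map (MulAut.conj g₂).toMonoidHom =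
      (((𝒢.branchSubgroup b₂ v h₂).map (MulAut.conj y).toMonoidHom).map φ.toMonoidHom).map
        (MulAut.conj g₁).toMonoidHom := by
    rw [Subgroup.map_map, hnat, ← Subgroup.map_map, ← Subgroup.map_map]
  rw [h2]
  -- estrangement in `Π_v`, transported by the injective `conj g₁ ∘ φ`
  have hest := (h𝒢.isTotallyEstranged (𝒢.graph.edgeOf b₁)).2 b₁ rfl v h₁ b₂ h₂ (1⁻¹ * y)
    (Or.inl (Ne.symm hne))
  have hinj : Function.Injective ((MulAut.conj g₁).toMonoidHom.comp φ.toMonoidHom) :=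
    (MulAut.conj g₁).injective.comp ((hVI 𝒢 h𝒢 c v).2 φ hφ)
  have key := map_conj_inf_map_conj_eq_bot ((MulAut.conj g₁).toMonoidHom.comp φ.toMonoidHom) hinj
    (𝒢.branchSubgroup b₁ v h₁) (𝒢.branchSubgroup b₂ v h₂) 1 y hest
  have h1 : (𝒢.branchSubgroup b₁ v h₁).map (MulAut.conj (1 : 𝒢.Gv v)).toMonoidHom =
      𝒢.branchSubgroup b₁ v h₁ := by
    ext x; simp
  rw [h1, ← Subgroup.map_map, ← Subgroup.map_map] at key
  exact key

/-! ### Edge-like subgroups are infinite -/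

/-- **`Π_b ≠ Π_v`** at an elevated vertex (Def 2.4 (i) with `M = 2`: if `b_*` were onto, the branch image in a
`π₁`-epimorphic approximator would be all of `F_v` by `Approximator.comm`, leaving no room for `N_M`).
[cite: MochizukiSemiAnbd2006, Def 2.4(i) p.26] -/
theorem branchSubgroup_ne_top (hel : 𝒢.IsTotallyElevated) {b : 𝒢.graph.Branch} {v : 𝒢.graph.Vertex}
    (h : 𝒢.graph.abuts b = some v) : 𝒢.branchSubgroup b v h ≠ ⊤ := by
  intro htop
  obtain ⟨A, hA, N, hN2, hN⟩ := hel v 2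
  obtain ⟨g, hg⟩ := A.comm b v h
  -- the branch image in `F_v` is everything
  have hfull : ((A.brF b v h).range.map (MulAut.conj g⁻¹).toMonoidHom) = ⊤ := by
    rw [eq_top_iff]
    intro y _
    obtain ⟨z, rfl⟩ := hA.1 v y
    have hz : z ∈ 𝒢.branchSubgroup b v h := by rw [htop]; exact Subgroup.mem_top z
    obtain ⟨x, rfl⟩ := hz
    refine ⟨A.brF b v h (A.πE _ x), ⟨_, rfl⟩, ?_⟩
    simp only [MulEquiv.coe_toMonoidHom, MulAut.conj_apply, inv_inv, hg x,
      ContinuousMonoidHom.coe_toMonoidHom]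
    simp [mul_assoc]
  have hbot := hN b h g⁻¹
  rw [hfull, inf_top_eq] at hbot
  rw [hbot, Subgroup.card_bot] at hN2
  omega

/-- **`Π_b` is infinite** (aloofness at `(b, b, g ∉ Π_b)`, such `g` existing by `branchSubgroup_ne_top`).
[cite: MochizukiSemiAnbd2006, Def 2.4(iv) p.26] -/
theorem infinite_branchSubgroup (h𝒢 : 𝒢.Prop36Hypotheses) {b : 𝒢.graph.Branch} {v : 𝒢.graph.Vertex}
    (h : 𝒢.graph.abuts b = some v) : Infinite (𝒢.branchSubgroup b v h) := by
  have hne := branchSubgroup_ne_top h𝒢.isTotallyElevated h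
  obtain ⟨g, hg⟩ : ∃ g : 𝒢.Gv v, g ∉ 𝒢.branchSubgroup b v h := by
    by_contra hall
    push Not at hall
    exact hne (eq_top_iff.mpr fun x _ => hall x)
  have h0 := h𝒢.isTotallyAloof (𝒢.graph.edgeOf b) b rfl v h b h g (Or.inr hg)
  by_contra hfin
  rw [not_infinite_iff_finite] at hfin
  haveI : (((𝒢.branchSubgroup b v h).map (MulAut.conj g).toMonoidHom).subgroupOf
      (𝒢.branchSubgroup b v h)).FiniteIndex := Subgroup.finiteIndex_of_finite
  exact Subgroup.FiniteIndex.index_ne_zero h0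

/-- **Edge-like subgroups are infinite** ("all of the edge-like subgroups of `π₁^temp(ℋ)` are infinite",
proof of Cor 3.9 p. 42): `L = gφ(Π_b)g⁻¹ ≅ Π_b` for an abutting branch `b` of `e` (connectedness) and an
injective verticial `φ` (Thm 3.7 (i)). [cite: MochizukiSemiAnbd2006, Cor. 3.9 p.42] -/
theorem infinite_of_mem_edgeLikeSubgroups (hVI : VerticialInjective.{u}) (h𝒢 : 𝒢.Thm37Hypotheses)
    (c : TemperedPiChart 𝒢) {e : 𝒢.graph.Edge} {L : Subgroup c.G} (hL : L ∈ edgeLikeSubgroups c e) :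
    Infinite L := by
  obtain ⟨w⟩ := h𝒢.hasVertex
  obtain ⟨b, hbe, hs⟩ := SemiGraph.exists_abuts_of_isConnected h𝒢.isConnected w e
  obtain ⟨v, h⟩ := Option.isSome_iff_exists.mp hs
  subst hbe
  obtain ⟨H, φ, hφ, rfl⟩ := (hVI 𝒢 h𝒢 c v).1
  obtain ⟨g, rfl⟩ := edgeLike_eq_map_branchSubgroup c h hL φ hφ
  haveI := infinite_branchSubgroup h𝒢.toProp36Hypotheses h
  have hinj : Function.Injective ((MulAut.conj g).toMonoidHom.comp φ.toMonoidHom) :=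
    (MulAut.conj g).injective.comp ((hVI 𝒢 h𝒢 c v).2 φ hφ)
  rw [Subgroup.map_map]
  exact Infinite.of_injective _ (Subgroup.equivMapOfInjective _ _ hinj).injective

/-! ### Edge-like subgroups of distinct edges meet trivially -/

/-- The identification step used four times: if `K ≠ 1` lies in `gφ_u(Π_b)g⁻¹` (branch `b` at `u`) and in
`g₁φ_{v₁}(Π_{b₁})g₁⁻¹` (branch `b₁` at `v₁`) and the two verticial hosts coincide, then `b = b₁`
(`VerticialDistinct` clause 1 gives `u = v₁`, then LEMMA E). [cite: MochizukiSemiAnbd2006, Thm 3.7(iii) p.41] -/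
theorem branch_eq_of_hosts_eq (hVD : VerticialDistinct.{u}) (hVI : VerticialInjective.{u})
    (h𝒢 : 𝒢.Thm37Hypotheses) (c : TemperedPiChart 𝒢) (Φ : ∀ v : 𝒢.graph.Vertex, 𝒢.Gv v →ₜ* c.G)
    (hΦ : ∀ v, IsVerticialHom c v (Φ v)) {K : Subgroup c.G} (hK : K ≠ ⊥) {u v₁ : 𝒢.graph.Vertex}
    {b b₁ : 𝒢.graph.Branch} (hb : 𝒢.graph.abuts b = some u) (hb₁ : 𝒢.graph.abuts b₁ = some v₁)
    (g g₁ : c.G)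
    (hKL : K ≤ ((𝒢.branchSubgroup b u hb).map (Φ u).toMonoidHom).map (MulAut.conj g).toMonoidHom)
    (hKL₁ : K ≤ ((𝒢.branchSubgroup b₁ v₁ hb₁).map (Φ v₁).toMonoidHom).map (MulAut.conj g₁).toMonoidHom)
    (hH : (Φ u).toMonoidHom.range.map (MulAut.conj g).toMonoidHom =
      (Φ v₁).toMonoidHom.range.map (MulAut.conj g₁).toMonoidHom) : b = b₁ := by
  -- the hosts are verticial subgroups of `u` and of `v₁`; equal hosts force `u = v₁`
  have hu : u = v₁ := by
    by_contra huv
    have h0 := (hVD 𝒢 h𝒢 c).1 u v₁ _ _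
      (conj_mem_verticialSubgroups c (range_mem_verticialSubgroups c (Φ u) (hΦ u)) g)
      (conj_mem_verticialSubgroups c (range_mem_verticialSubgroups c (Φ v₁) (hΦ v₁)) g₁) huv
    rw [hH, Subgroup.relIndex_self] at h0
    exact one_ne_zero h0
  subst hu
  by_contra hbb
  have hbot := map_branch_inf_eq_bot_of_ne hVD hVI h𝒢 c (Φ u) (hΦ u) hb hb₁ hbb g g₁ hH
  exact hK (eq_bot_iff.mpr (le_inf hKL hKL₁ |>.trans hbot.le))

/-- **Edge-like subgroups of distinct edges meet trivially.** [cite: MochizukiSemiAnbd2006, Thm 3.7(iv) p.41] -/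
theorem edgeLike_inf_edgeLike_eq_bot (hCV : CompactInVerticial.{u}) (hVD : VerticialDistinct.{u})
    (hVI : VerticialInjective.{u}) (h𝒢 : 𝒢.Thm37Hypotheses) (c : TemperedPiChart 𝒢)
    {e₁ e₂ : 𝒢.graph.Edge} (hne : e₁ ≠ e₂) {L₁ L₂ : Subgroup c.G} (hL₁ : L₁ ∈ edgeLikeSubgroups c e₁)
    (hL₂ : L₂ ∈ edgeLikeSubgroups c e₂) : L₁ ⊓ L₂ = ⊥ := by
  classical
  haveI := TemperedPiChart.t2Space c
  -- one verticial homomorphism per vertex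
  have hΦ' : ∀ v : 𝒢.graph.Vertex, ∃ φ : 𝒢.Gv v →ₜ* c.G, IsVerticialHom c v φ := by
    intro v
    obtain ⟨H, φ, hφ, -⟩ := (hVI 𝒢 h𝒢 c v).1
    exact ⟨φ, hφ⟩
  choose Φ hΦ using hΦ'
  -- attached branches of `e₁`, `e₂`
  obtain ⟨w⟩ := h𝒢.hasVertex
  obtain ⟨b₁, hbe₁, hs₁⟩ := SemiGraph.exists_abuts_of_isConnected h𝒢.isConnected w e₁
  obtain ⟨b₂, hbe₂, hs₂⟩ := SemiGraph.exists_abuts_of_isConnected h𝒢.isConnected w e₂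
  obtain ⟨v₁, hb₁⟩ := Option.isSome_iff_exists.mp hs₁
  obtain ⟨v₂, hb₂⟩ := Option.isSome_iff_exists.mp hs₂
  subst hbe₁ hbe₂
  have hb₁₂ : b₁ ≠ b₂ := fun h => hne (by rw [h])
  obtain ⟨g₁, hL₁eq⟩ := edgeLike_eq_map_branchSubgroup c hb₁ hL₁ (Φ v₁) (hΦ v₁)
  obtain ⟨g₂, hL₂eq⟩ := edgeLike_eq_map_branchSubgroup c hb₂ hL₂ (Φ v₂) (hΦ v₂)
  -- the hosts
  set H₁ := (Φ v₁).toMonoidHom.range.map (MulAut.conj g₁).toMonoidHom with hH₁def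
  set H₂ := (Φ v₂).toMonoidHom.range.map (MulAut.conj g₂).toMonoidHom with hH₂def
  have hH₁ : H₁ ∈ verticialSubgroups c v₁ :=
    conj_mem_verticialSubgroups c (range_mem_verticialSubgroups c (Φ v₁) (hΦ v₁)) g₁
  have hH₂ : H₂ ∈ verticialSubgroups c v₂ :=
    conj_mem_verticialSubgroups c (range_mem_verticialSubgroups c (Φ v₂) (hΦ v₂)) g₂
  have hL₁H₁ : L₁ ≤ H₁ := by rw [hL₁eq]; exact Subgroup.map_mono (Subgroup.map_le_range _ _)
  have hL₂H₂ : L₂ ≤ H₂ := by rw [hL₂eq]; exact Subgroup.map_mono (Subgroup.map_le_range _ _)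
  by_contra hK
  -- Case I: equal hosts
  by_cases hH12 : H₁ = H₂
  · exact hb₁₂ (branch_eq_of_hosts_eq hVD hVI h𝒢 c Φ hΦ hK hb₁ hb₂ g₁ g₂
      (by rw [← hL₁eq]; exact inf_le_left) (by rw [← hL₂eq]; exact inf_le_right) hH12)
  -- Case II: distinct hosts; `K = L₁ ⊓ L₂` is compact and nontrivial
  have hKc : IsCompact ((L₁ ⊓ L₂ : Subgroup c.G) : Set c.G) := by
    rw [Subgroup.coe_inf]
    exact (isCompact_of_mem_edgeLikeSubgroups c hL₁).inter_right
      (isCompact_of_mem_edgeLikeSubgroups c hL₂).isClosed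
  obtain ⟨honly, e, L, he, hL, hKL⟩ := (hCV 𝒢 h𝒢 c (L₁ ⊓ L₂) hKc).2 hK v₁ v₂ H₁ H₂ hH₁ hH₂ hH12
    (inf_le_left.trans hL₁H₁) (inf_le_right.trans hL₂H₂)
  obtain ⟨b, b', u, u', hbb', hbe, hb'e, hb, hb'⟩ := SemiGraph.exists_branches_of_isClosedEdge he
  subst hbe
  obtain ⟨g, hLeq⟩ := edgeLike_eq_map_branchSubgroup c hb hL (Φ u) (hΦ u)
  have hL' : L ∈ edgeLikeSubgroups c (𝒢.graph.edgeOf b') := by rw [hb'e]; exact hL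
  obtain ⟨g', hLeq'⟩ := edgeLike_eq_map_branchSubgroup c hb' hL' (Φ u') (hΦ u')
  set H := (Φ u).toMonoidHom.range.map (MulAut.conj g).toMonoidHom with hHdef
  set H' := (Φ u').toMonoidHom.range.map (MulAut.conj g').toMonoidHom with hH'def
  have hHm : H ∈ verticialSubgroups c u :=
    conj_mem_verticialSubgroups c (range_mem_verticialSubgroups c (Φ u) (hΦ u)) g
  have hH'm : H' ∈ verticialSubgroups c u' :=
    conj_mem_verticialSubgroups c (range_mem_verticialSubgroups c (Φ u') (hΦ u')) g'
  have hKH : L₁ ⊓ L₂ ≤ H := hKL.trans (by rw [hLeq]; exact Subgroup.map_mono (Subgroup.map_le_range _ _))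
  have hKH' : L₁ ⊓ L₂ ≤ H' :=
    hKL.trans (by rw [hLeq']; exact Subgroup.map_mono (Subgroup.map_le_range _ _))
  -- membership data for `branch_eq_of_hosts_eq`
  have hKLb : L₁ ⊓ L₂ ≤ ((𝒢.branchSubgroup b u hb).map (Φ u).toMonoidHom).map (MulAut.conj g).toMonoidHom := by
    rw [← hLeq]; exact hKL
  have hKLb' : L₁ ⊓ L₂ ≤
      ((𝒢.branchSubgroup b' u' hb').map (Φ u').toMonoidHom).map (MulAut.conj g').toMonoidHom := by
    rw [← hLeq']; exact hKL
  have hKL₁ : L₁ ⊓ L₂ ≤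
      ((𝒢.branchSubgroup b₁ v₁ hb₁).map (Φ v₁).toMonoidHom).map (MulAut.conj g₁).toMonoidHom := by
    rw [← hL₁eq]; exact inf_le_left
  have hKL₂ : L₁ ⊓ L₂ ≤
      ((𝒢.branchSubgroup b₂ v₂ hb₂).map (Φ v₂).toMonoidHom).map (MulAut.conj g₂).toMonoidHom := by
    rw [← hL₂eq]; exact inf_le_right
  -- the two hosts of `L` are among `H₁`, `H₂`
  rcases honly u H hHm hKH with hH1 | hH2 <;> rcases honly u' H' hH'm hKH' with hH'1 | hH'2
  · -- H = H₁ = H' : the two branches of `e` inside one host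
    exact hbb' (branch_eq_of_hosts_eq hVD hVI h𝒢 c Φ hΦ hK hb hb' g g' hKLb hKLb' (hH1.trans hH'1.symm))
  · -- H = H₁, H' = H₂ : `b = b₁`, `b' = b₂`, so `e₁ = e = e₂`
    have h1 := branch_eq_of_hosts_eq hVD hVI h𝒢 c Φ hΦ hK hb hb₁ g g₁ hKLb hKL₁ hH1
    have h2 := branch_eq_of_hosts_eq hVD hVI h𝒢 c Φ hΦ hK hb' hb₂ g' g₂ hKLb' hKL₂ hH'2
    subst h1 h2
    exact hne hb'e.symm
  · -- H = H₂, H' = H₁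
    have h1 := branch_eq_of_hosts_eq hVD hVI h𝒢 c Φ hΦ hK hb hb₂ g g₂ hKLb hKL₂ hH2
    have h2 := branch_eq_of_hosts_eq hVD hVI h𝒢 c Φ hΦ hK hb' hb₁ g' g₁ hKLb' hKL₁ hH'1
    subst h1 h2
    exact hne hb'e
  · -- H = H₂ = H'
    exact hbb' (branch_eq_of_hosts_eq hVD hVI h𝒢 c Φ hΦ hK hb hb' g g' hKLb hKLb' (hH2.trans hH'2.symm))

/-- **`EdgeLikeDistinct`, unfolded**: for distinct edges `e₁ ≠ e₂` and edge-like subgroups `L₁`, `L₂`,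
`[L₁ : L₁ ∩ L₂] = ∞`, i.e. `L₂.relIndex L₁ = 0` (trivial intersection, infinite `L₁`).
[cite: MochizukiSemiAnbd2006, Thm 3.7(iv) p.41] -/
theorem relIndex_edgeLike_eq_zero (hCV : CompactInVerticial.{u}) (hVD : VerticialDistinct.{u})
    (hVI : VerticialInjective.{u}) (h𝒢 : 𝒢.Thm37Hypotheses) (c : TemperedPiChart 𝒢)
    {e₁ e₂ : 𝒢.graph.Edge} (hne : e₁ ≠ e₂) {L₁ L₂ : Subgroup c.G} (hL₁ : L₁ ∈ edgeLikeSubgroups c e₁)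
    (hL₂ : L₂ ∈ edgeLikeSubgroups c e₂) : L₂.relIndex L₁ = 0 := by
  haveI := infinite_of_mem_edgeLikeSubgroups hVI h𝒢 c hL₁
  have hbot : L₂ ⊓ L₁ = ⊥ := by rw [inf_comm]; exact edgeLike_inf_edgeLike_eq_bot hCV hVD hVI h𝒢 c hne hL₁ hL₂
  rw [← Subgroup.inf_relIndex_right, hbot, Subgroup.relIndex_bot_left]
  exact Nat.card_eq_zero_of_infinite

end ProfiniteSemiGraph

end Literature.AnabelianGeometry.SemiGraphs
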